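import Summits.Ventures.CertifiedManyBodySolver.Observables.StiffnessThermalCouplingDilution
import Summits.Ventures.CertifiedManyBodySolver.Observables.StiffnessThermalLeafAtBeta
import Summits.Ventures.CertifiedManyBodySolver.Observables.StiffnessApexTransportFanDoped
import Literature.MathematicalPhysics.QuantumLattice.HubbardTTPrimeApexRowThermal
import HarnessLib

/-!
# Ventures/CertifiedManyBodySolver — Observables/StiffnessApexTransportThermal.lean

HONEST FRAMING: one-sided certified CEILINGS on the THERMAL uniform flux stiffness (t–t′ f-sum class) at ONE inverse temperature,
TRANSPORTED along the rays `βU = const` of the `(t′, U, T)` space; conditional on the thermal source row named; a ceiling never speaks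
to the presence of order; a `T_KT` bound only through the KT dictionary hypothesis; not a superconductivity verdict; no phase sentence.
Zero compute, no definition, no claim node, no `sorry`.

Cell `pub/hubbard-downfold` (D-0150 L-DF2 «box ↦ one word», `T > 0` leg of D-0096/D-0099: the phase map's cells are `T × couplings`), seat
`hubbard-downfold-unc-2` (`prover-hubbard-downfold-unc-2-g16-0`); the `T > 0` twin of `Observables/StiffnessApexTransport.lean`, built on
`Literature/…/HubbardTTPrimeApexRowThermal` (THE THERMAL APEX ROW: for canonical Gibbs torus limits `ω_A` at `(β_A; 1, t′_A, U_A, n)` and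
`ω_P` at `(β_P; 1, t′_P, U_P, n)` with `β_A U_A = β_P U_P`, `β_P < β_A`: `e_{Φ(1,κ,0)}(ω_A) ≤ e_{Φ(1,κ,0)}(ω_P)`,
`κ = (β_A t′_A − β_P t′_P)/(β_A − β_P)` — cross Peierls–Bogoliubov, the entropies cancel with the double occupancy) and on hubbard-tc's
thermal f-sum dictionary `Re ω(k₀^{tt′}) = −½ e_{Φ(1,2t′,0)}(ω)` (`StiffnessThermalCouplingDilution` §1; thermal torus limits are `D₄`-invariant).

* §1 EXACT APEX (`β_A t′_A = (2β_A − β_P) t′_P`, i.e. `κ = 2t′_P`): a thermal floor `ℓ ≤ e_{Φ(1,2t′_P,0)}` on the SOURCE class ⇒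
  `ObsThermalStiffnessSeqCeilingAtBeta t′_P U_P n β_P c` for `c ≥ −ℓ/4`; the `t′ = 0` ray: the source's own kinetic word IS the target's;
* §2 READER SHAPES: the source word as hubbard-tc's route T-A input `Re ω_A(k₀^{tt′_A}) ≤ 2c_A` — at `t′ = 0`: `…AtBeta 0 U_P n (β_A U_A/U_P) c_A`
  for every `U_P > U_A`; at `t′ ≠ 0`: the source's own word + its `K₂` bracket, price `[(2t′_P − 2t′_A)⁺(−B_A) + (2t′_A − 2t′_P)⁺A_A]/4`;
* §3 KT closure along the ray (`ThermalKTDictionaryAt.le_inv_of_leafAtBeta`): `(π/4)c < 1/β_P ⇒ T_c(U_P) ≤ 1/β_P = U_P/(β_A U_A)`.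

NOT said: nothing off the ray (a thermal word at `(β, U)` says nothing here about `(β, U')`); nothing toward smaller `U`; no `∀β` leaf;
the half-filling sign of `K₂` for thermal states is not used (brackets only).

References: E. H. Lieb, Commun. Math. Phys. 31 (1973) 327, §V (5.2)–(5.4) [Lieb1973]; T. Hazra, N. Verma, M. Randeria, PRX 9 (2019) 031049,
eqs. (2)–(4) [HazraVermaRanderia2019]; D. J. Scalapino, S. R. White, S.-C. Zhang, PRB 47 (1993) 7995, §II [ScalapinoWhiteZhang1993];
T. Koma, H. Tasaki, J. Stat. Phys. 76 (1994) 745, §1 [KomaTasaki1994].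
-/

noncomputable section

namespace Summit.Ventures.CertifiedManyBodySolver.Observables

open Filter Topology Matrix Finset
open Literature.MathematicalPhysics.QuantumLattice
open Literature.MathematicalPhysics.QuantumLattice.InfVolFermionState
open Literature.MathematicalPhysics.QuantumLattice.ThermodynamicLimit
open Literature.MathematicalPhysics.QuantumFieldTheory
open Literature.MathematicalPhysics.StatisticalMechanics
open Literature.MathematicalPhysics.StatisticalMechanics.KosterlitzThouless
open Literature.Probability.LatticeModels
open scoped ComplexConjugate ComplexOrder

/-! ## §1 Exact apex: a thermal floor at the source is a thermal stiffness ceiling at the target -/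

section Exact

variable {t'A UA t'P UP βA βP n : ℝ}

/-- **THERMAL APEX TRANSPORT OF THE f-SUM STIFFNESS CEILING.** `0 ≤ n ≤ 2`, `0 < β_P < β_A`, `β_A U_A = β_P U_P`, and the source on the
target's thermal apex segment: `β_A t′_A = (2β_A − β_P) t′_P`. If `ℓ ≤ e_{Φ(1,2t′_P,0)}(ω_A)` for EVERY torus limit `ω_A` of the canonical
sector Gibbs states of `hubbardTorusTT' L 1 t′_A U_A` at `(β_A, n)` (a certified thermal FLOOR on the doubled-hopping energy — the shape of a
thermal f-sum word), then `ObsThermalStiffnessSeqCeilingAtBeta t′_P U_P n β_P c` for every `c ≥ −ℓ/4`: the thermal apex row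
(`le_meanEnergy_twice_tPrime_of_forall_source_thermal`) moves the floor to every thermal torus limit at `P`, where the `D₄`-invariant f-sum
dictionary reads `Re ω_P(k₀^{tt′_P}) = −½ e_{Φ(1,2t′_P,0)}(ω_P) ≤ −ℓ/2 = 2c`. [cite: Lieb1973, §V (5.2)–(5.4)] [cite: HazraVermaRanderia2019, eq. (4)] -/
theorem ObsThermalStiffnessSeqCeilingAtBeta_of_thermalApexSource_floor (hn0 : 0 ≤ n) (hn2 : n ≤ 2) (hβP : 0 < βP) (hβ : βP < βA)
    (hγ : βA * UA = βP * UP) (hapex : βA * t'A = (2 * βA - βP) * t'P) {ℓ : ℝ}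
    (hℓ : ∀ (ωA : InfVolFermionState 2) (LsA : ℕ → ℕ), Tendsto LsA atTop atTop →
      ωA.IsTorusLimitOfMixture (sectorGibbsCount n) (fun L => sectorGibbsWeightTT' βA 1 t'A UA n L)
        (fun L => sectorGibbsVectorTT' 1 t'A UA n L) LsA →
      ℓ ≤ ωA.meanEnergy (hubbardTTPrimeFermionInteraction 1 (2 * t'P) 0) 1)
    (c : ℚ) (hc : -ℓ / 4 ≤ ((c : ℚ) : ℝ)) :
    ObsThermalStiffnessSeqCeilingAtBeta t'P UP n βP c := by
  refine ObsThermalStiffnessSeqCeilingAtBeta_of_torusLimit_kinetic_le hβP hn0 hn2 fun ω Ls hLs hω => ?_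
  have hfl := IsTorusLimitOfMixture.le_meanEnergy_twice_tPrime_of_forall_source_thermal (t := 1) hn0 hn2 hβ hγ hapex hℓ hω hLs
  rw [re_expect_kinBondObsTT_eq_of_isD4Invariant hω.isTranslationInvariant (hω.isD4Invariant_of_sectorGibbs 1 t'P UP n βP hLs) t'P]
  have hco := InfVolFermionState.meanEnergy_hubbardTTPrime_eq_coords ω 1 (2 * t'P) 0
  rw [one_mul, zero_mul, add_zero] at hco
  rw [← hco]
  linarith

/-- **THE `t′ = 0` RAY: the kinetic floor at `(β_A, U_A)` is a thermal stiffness ceiling at every `(β_A U_A/U_P, U_P)`, `U_P > U_A`.**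
`0 ≤ n ≤ 2`, `0 < β_P < β_A`, `β_A U_A = β_P U_P`; `ℓ ≤ e_{Φ(1,0,0)}(ω_A)` on the thermal class at `(β_A; 1, 0, U_A, n)` ⇒
`ObsThermalStiffnessSeqCeilingAtBeta 0 U_P n β_P c` for `c ≥ −ℓ/4`. [cite: Lieb1973, §V (5.2)–(5.4)] [cite: HazraVermaRanderia2019, eq. (4)] -/
theorem ObsThermalStiffnessSeqCeilingAtBeta_tp0_of_isoBetaU_kinetic_floor (hn0 : 0 ≤ n) (hn2 : n ≤ 2) (hβP : 0 < βP) (hβ : βP < βA)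
    (hγ : βA * UA = βP * UP) {ℓ : ℝ}
    (hℓ : ∀ (ωA : InfVolFermionState 2) (LsA : ℕ → ℕ), Tendsto LsA atTop atTop →
      ωA.IsTorusLimitOfMixture (sectorGibbsCount n) (fun L => sectorGibbsWeightTT' βA 1 0 UA n L)
        (fun L => sectorGibbsVectorTT' 1 0 UA n L) LsA →
      ℓ ≤ ωA.meanEnergy (hubbardTTPrimeFermionInteraction 1 0 0) 1)
    (c : ℚ) (hc : -ℓ / 4 ≤ ((c : ℚ) : ℝ)) :
    ObsThermalStiffnessSeqCeilingAtBeta 0 UP n βP c :=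
  ObsThermalStiffnessSeqCeilingAtBeta_of_thermalApexSource_floor (t'A := 0) hn0 hn2 hβP hβ hγ (by ring)
    (by simpa only [mul_zero] using hℓ) c hc

end Exact

/-! ## §2 Reader shapes: the source word as a route T-A kinetic bound; own word + `K₂` bracket off the exact apex -/

section Reader

variable {t'A UA t'P UP βA βP n : ℝ}

/-- **Route T-A input at the source ⇒ the leaf at every point of its `t′ = 0` ray.** If `Re ω_A(k₀^{t,0}) ≤ 2c` for every torus limit of
the canonical sector Gibbs states at `(β_A; 1, 0, U_A, n)` (hubbard-tc's kinetic-bound input, `…AtBeta_of_torusLimit_kinetic_le`), then for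
every `U_P` with `β_A U_A = β_P U_P`, `0 < β_P < β_A`: `ObsThermalStiffnessSeqCeilingAtBeta 0 U_P n β_P c` — the SAME constant. So one
thermal kinetic certificate at `(β, U)` is a single-temperature leaf on the whole ray `{(βU/U', U') : U' ≥ U}`.
[cite: Lieb1973, §V (5.2)–(5.4)] [cite: HazraVermaRanderia2019, eq. (4)] -/
theorem ObsThermalStiffnessSeqCeilingAtBeta_tp0_of_isoBetaU_kinetic_le (hn0 : 0 ≤ n) (hn2 : n ≤ 2) (hβP : 0 < βP) (hβ : βP < βA)
    (hγ : βA * UA = βP * UP) {c : ℚ}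
    (hbound : ∀ (ωA : InfVolFermionState 2) (LsA : ℕ → ℕ), Tendsto LsA atTop atTop →
      ωA.IsTorusLimitOfMixture (sectorGibbsCount n) (fun L => sectorGibbsWeightTT' βA 1 0 UA n L)
        (fun L => sectorGibbsVectorTT' 1 0 UA n L) LsA →
      (ωA.expect (box 2 1) (kinBondObsTT 0)).re ≤ 2 * ((c : ℚ) : ℝ)) :
    ObsThermalStiffnessSeqCeilingAtBeta 0 UP n βP c := by
  refine ObsThermalStiffnessSeqCeilingAtBeta_tp0_of_isoBetaU_kinetic_floor hn0 hn2 hβP hβ hγ (ℓ := -4 * ((c : ℚ) : ℝ))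
    (fun ωA LsA hLsA hωA => ?_) c (by linarith)
  have h := hbound ωA LsA hLsA hωA
  rw [re_expect_kinBondObsTT_eq_of_isD4Invariant hωA.isTranslationInvariant (hωA.isD4Invariant_of_sectorGibbs 1 0 UA n βA hLsA) 0]
    at h
  have hco := InfVolFermionState.meanEnergy_hubbardTTPrime_eq_coords ωA 1 0 0
  rw [one_mul, zero_mul, zero_mul, add_zero, add_zero] at hco
  rw [hco]
  linarith

/-- **Own word + `K₂` bracket at the source, exact apex geometry.** `0 ≤ n ≤ 2`, `0 < β_P < β_A`, `β_A U_A = β_P U_P`,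
`β_A t′_A = (2β_A − β_P) t′_P`. The source's route T-A input at ITS OWN hopping, `Re ω_A(k₀^{tt′_A}) ≤ 2c_A` on the thermal class at
`(β_A; 1, t′_A, U_A, n)`, plus a bracket `B_A ≤ K₂(ω_A) ≤ A_A` there (`B_A ≤ 0 ≤ A_A`; e.g. the kinematic `∓1.6211390`, or the thermal
`K₂` words of `HubbardTTPrimeDiagHopTransportThermal`), give `ObsThermalStiffnessSeqCeilingAtBeta t′_P U_P n β_P c` for every
`c ≥ c_A + [(2t′_P − 2t′_A)⁺(−B_A) + (2t′_A − 2t′_P)⁺A_A]/4` (`meanEnergy_hopping_le_add_hinges` at the source).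
[cite: Lieb1973, §V (5.2)–(5.4)] [cite: KomaTasaki1994, §1] -/
theorem ObsThermalStiffnessSeqCeilingAtBeta_of_thermalApexSource_kinetic_le_of_bracket (hn0 : 0 ≤ n) (hn2 : n ≤ 2) (hβP : 0 < βP)
    (hβ : βP < βA) (hγ : βA * UA = βP * UP) (hapex : βA * t'A = (2 * βA - βP) * t'P) {cA : ℚ}
    (hbound : ∀ (ωA : InfVolFermionState 2) (LsA : ℕ → ℕ), Tendsto LsA atTop atTop →
      ωA.IsTorusLimitOfMixture (sectorGibbsCount n) (fun L => sectorGibbsWeightTT' βA 1 t'A UA n L)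
        (fun L => sectorGibbsVectorTT' 1 t'A UA n L) LsA →
      (ωA.expect (box 2 1) (kinBondObsTT t'A)).re ≤ 2 * ((cA : ℚ) : ℝ))
    {BA AA : ℝ} (hBA0 : BA ≤ 0) (hAA0 : 0 ≤ AA)
    (hBA : ∀ (ωA : InfVolFermionState 2) (LsA : ℕ → ℕ), Tendsto LsA atTop atTop →
      ωA.IsTorusLimitOfMixture (sectorGibbsCount n) (fun L => sectorGibbsWeightTT' βA 1 t'A UA n L)
        (fun L => sectorGibbsVectorTT' 1 t'A UA n L) LsA →
      BA ≤ ωA.meanEnergy (hubbardTTPrimeFermionInteraction 0 1 0) 1)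
    (hAA : ∀ (ωA : InfVolFermionState 2) (LsA : ℕ → ℕ), Tendsto LsA atTop atTop →
      ωA.IsTorusLimitOfMixture (sectorGibbsCount n) (fun L => sectorGibbsWeightTT' βA 1 t'A UA n L)
        (fun L => sectorGibbsVectorTT' 1 t'A UA n L) LsA →
      ωA.meanEnergy (hubbardTTPrimeFermionInteraction 0 1 0) 1 ≤ AA)
    (c : ℚ) (hc : ((cA : ℚ) : ℝ) + (max (2 * t'P - 2 * t'A) 0 * -BA + max (2 * t'A - 2 * t'P) 0 * AA) / 4 ≤ ((c : ℚ) : ℝ)) :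
    ObsThermalStiffnessSeqCeilingAtBeta t'P UP n βP c := by
  refine ObsThermalStiffnessSeqCeilingAtBeta_of_thermalApexSource_floor hn0 hn2 hβP hβ hγ hapex
    (ℓ := -4 * ((cA : ℚ) : ℝ) - (max (2 * t'P - 2 * t'A) 0 * -BA + max (2 * t'A - 2 * t'P) 0 * AA))
    (fun ωA LsA hLsA hωA => ?_) c (by linarith)
  have h := hbound ωA LsA hLsA hωA
  rw [re_expect_kinBondObsTT_eq_of_isD4Invariant hωA.isTranslationInvariant (hωA.isD4Invariant_of_sectorGibbs 1 t'A UA n βA hLsA) t'A]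
    at h
  have hco := InfVolFermionState.meanEnergy_hubbardTTPrime_eq_coords ωA 1 (2 * t'A) 0
  rw [one_mul, zero_mul, add_zero] at hco
  -- hinge at the source: `e_{2t′_A}(ω_A) ≤ e_{2t′_P}(ω_A) + hinges`
  have hh := meanEnergy_hopping_le_add_hinges ωA 1 (κ := 2 * t'P) (κ' := 2 * t'A) hBA0 hAA0 (hBA ωA LsA hLsA hωA)
    (hAA ωA LsA hLsA hωA)
  rw [hco] at hh
  linarith

/-- **Fully kinematic bracket form** (no `K₂` word at the source): `c ≥ c_A + |2t′_A − 2t′_P|·1.6211390/4` suffices.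
[cite: LiebLoss1993, §8, Theorem 8.2] [cite: Lieb1973, §V (5.2)–(5.4)] -/
theorem ObsThermalStiffnessSeqCeilingAtBeta_of_thermalApexSource_kinetic_le_kinematic (hn0 : 0 ≤ n) (hn2 : n < 2) (hβP : 0 < βP)
    (hβ : βP < βA) (hγ : βA * UA = βP * UP) (hapex : βA * t'A = (2 * βA - βP) * t'P) {cA : ℚ}
    (hbound : ∀ (ωA : InfVolFermionState 2) (LsA : ℕ → ℕ), Tendsto LsA atTop atTop →
      ωA.IsTorusLimitOfMixture (sectorGibbsCount n) (fun L => sectorGibbsWeightTT' βA 1 t'A UA n L)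
        (fun L => sectorGibbsVectorTT' 1 t'A UA n L) LsA →
      (ωA.expect (box 2 1) (kinBondObsTT t'A)).re ≤ 2 * ((cA : ℚ) : ℝ))
    (c : ℚ) (hc : ((cA : ℚ) : ℝ) + |2 * t'A - 2 * t'P| * 1.6211390 / 4 ≤ ((c : ℚ) : ℝ)) :
    ObsThermalStiffnessSeqCeilingAtBeta t'P UP n βP c := by
  have hK := fun (ωA : InfVolFermionState 2) (LsA : ℕ → ℕ) (hLsA : Tendsto LsA atTop atTop)
      (hωA : ωA.IsTorusLimitOfMixture (sectorGibbsCount n) (fun L => sectorGibbsWeightTT' βA 1 t'A UA n L)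
        (fun L => sectorGibbsVectorTT' 1 t'A UA n L) LsA) =>
    abs_le.1 (hωA.abs_meanEnergy_diagHop_le_decimal hn0 hn2 hLsA
      (fun L i => sectorGibbsWeightTT'_nonneg βA 1 t'A UA n L i) (fun L => sum_sectorGibbsWeightTT' βA 1 t'A UA hn0 hn2.le L)
      (fun L i => isNParticle_sectorGibbsVectorTT' 1 t'A UA n L i) (fun L i => star_sectorGibbsVectorTT'_dotProduct_self 1 t'A UA n L i))
  refine ObsThermalStiffnessSeqCeilingAtBeta_of_thermalApexSource_kinetic_le_of_bracket hn0 hn2.le hβP hβ hγ hapex hbound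
    (BA := -(1.6211390 : ℝ)) (AA := 1.6211390) (by norm_num) (by norm_num) (fun ωA LsA hLsA hωA => (hK ωA LsA hLsA hωA).1)
    (fun ωA LsA hLsA hωA => (hK ωA LsA hLsA hωA).2) c ?_
  have habs : max (2 * t'P - 2 * t'A) 0 * -(-(1.6211390 : ℝ)) + max (2 * t'A - 2 * t'P) 0 * 1.6211390 =
      |2 * t'A - 2 * t'P| * 1.6211390 := by
    rcases le_total (2 * t'A) (2 * t'P) with h | h
    · rw [max_eq_left (by linarith), max_eq_right (by linarith), abs_of_nonpos (by linarith)]; ring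
    · rw [max_eq_right (by linarith), max_eq_left (by linarith), abs_of_nonneg (by linarith)]; ring
  rw [habs]
  linarith

end Reader

/-! ## §3 KT closure along the ray -/

section KT

open Real

variable {t'A UA t'P UP βA βP n : ℝ} {ρe : ℝ → ℝ} {Tc : ℝ}

/-- **`T_KT` along the `βU = const` ray.** With the KT dictionary at the TARGET `(U_P, n, t′_P)` and the thermal apex leaf of §1 fed by a source
floor `ℓ`: `(π/4)·(−ℓ/4) < 1/β_P ⇒ Tc ≤ 1/β_P` — i.e. a thermal f-sum word certified at `(β_A, U_A)` bounds `T_c` at every larger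
coupling `U_P` on the ray by `U_P/(β_A U_A)` once `(π/16)(−ℓ)·β_A U_A < U_P`. Monotonicity-free; conditional on the dictionary.
[cite: HazraVermaRanderia2019, eqs. (2)–(3)] [cite: Lieb1973, §V (5.2)–(5.4)] -/
theorem ThermalKTDictionaryAt.le_inv_of_thermalApexSource_floor (hT : ThermalKTDictionaryAt t'P UP n ρe Tc) (hn0 : 0 ≤ n)
    (hn2 : n ≤ 2) (hβP : 0 < βP) (hβ : βP < βA) (hγ : βA * UA = βP * UP) (hapex : βA * t'A = (2 * βA - βP) * t'P) {ℓ : ℝ}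
    (hℓ : ∀ (ωA : InfVolFermionState 2) (LsA : ℕ → ℕ), Tendsto LsA atTop atTop →
      ωA.IsTorusLimitOfMixture (sectorGibbsCount n) (fun L => sectorGibbsWeightTT' βA 1 t'A UA n L)
        (fun L => sectorGibbsVectorTT' 1 t'A UA n L) LsA →
      ℓ ≤ ωA.meanEnergy (hubbardTTPrimeFermionInteraction 1 (2 * t'P) 0) 1)
    (c : ℚ) (hc : -ℓ / 4 ≤ ((c : ℚ) : ℝ)) (hlt : π / 4 * ((c : ℚ) : ℝ) < 1 / βP) : Tc ≤ 1 / βP :=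
  hT.le_inv_of_leafAtBeta hβP
    (ObsThermalStiffnessSeqCeilingAtBeta_of_thermalApexSource_floor hn0 hn2 hβP hβ hγ hapex hℓ c hc) hlt

/-- **`T_KT` along the `t′ = 0` ray from a route T-A input at the source**: `Re ω_A(k₀) ≤ 2c` on the thermal class at `(β_A; 1, 0, U_A, n)`,
`β_A U_A = β_P U_P`, `0 < β_P < β_A`, the KT dictionary at `(U_P, n, 0)` and `(π/4)c < 1/β_P` ⇒ `Tc ≤ 1/β_P`.
[cite: HazraVermaRanderia2019, eqs. (2)–(3)] [cite: Lieb1973, §V (5.2)–(5.4)] -/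
theorem ThermalKTDictionaryAt.le_inv_tp0_of_isoBetaU_kinetic_le (hT : ThermalKTDictionaryAt 0 UP n ρe Tc) (hn0 : 0 ≤ n)
    (hn2 : n ≤ 2) (hβP : 0 < βP) (hβ : βP < βA) (hγ : βA * UA = βP * UP) {c : ℚ}
    (hbound : ∀ (ωA : InfVolFermionState 2) (LsA : ℕ → ℕ), Tendsto LsA atTop atTop →
      ωA.IsTorusLimitOfMixture (sectorGibbsCount n) (fun L => sectorGibbsWeightTT' βA 1 0 UA n L)
        (fun L => sectorGibbsVectorTT' 1 0 UA n L) LsA →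
      (ωA.expect (box 2 1) (kinBondObsTT 0)).re ≤ 2 * ((c : ℚ) : ℝ))
    (hlt : π / 4 * ((c : ℚ) : ℝ) < 1 / βP) : Tc ≤ 1 / βP :=
  hT.le_inv_of_leafAtBeta hβP (ObsThermalStiffnessSeqCeilingAtBeta_tp0_of_isoBetaU_kinetic_le hn0 hn2 hβP hβ hγ hbound) hlt

end KT

end Summit.Ventures.CertifiedManyBodySolver.Observables

end
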